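import Literature.AnabelianGeometry.EtaleTheta.Discharge.Sec5OfConnectedTemperoid

/-!
# [EtTh] §5 tower over the GENUINE CONNECTED base `B^temp(Π^tp_X)⁰`: `ρ_comm_β`, `hopen`, `σ`, `hH` discharged (Rmk. 4.3.2 pp.318–319; §5 pp.330–331 / PDF pp.92–93, 104–105)

Mochizuki, *The étale theta function …*, Publ. RIMS **45** (2009)
[cite: MochizukiEtTh2009, Rmk 4.3.2 p.318–319 (PDF pp.92–93); §5 p.330–331 (PDF pp.104–105)].  Seat abc-iut-L2-t4 (§5 owner), ROW
W3-L2-01 «§5 GENUINE DATA» — tower companion of `Discharge/Sec5OfConnectedTemperoid.lean` (RE-BASE of the tower part of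
`Discharge/Sec5OfTemperoidModelData.lean`, p423781, onto `ConnectedPart (BTemp X.Pi)` after F-w4d099-1).  Additive.

* the tower's outer `ρ`-equivariance along `β^bs_{N,N'}` is a THEOREM over `B^temp(Π^tp_X)⁰`: `rho_comm_β_of_natural` (p420900)
  fed with the naturality theorem `mkOfConnectedTemperoid_galoisSurj_natural` + the Rmk. 4.3.2 square (inlined below);
* `ThetaFrobenioidTower.ofConnectedTemperoidFamily` — `ofBiKummerFamily` over `mkOfConnectedTemperoid` with `hopen`, `σ = s^trv_N`
  (constructed), `hdivc`/`hdivp` (from `hinvc`/`hinvp`) and `ρ_comm_β` DISCHARGED; inputs left: the Rmk. 4.3.2 transitions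
  `(α_{N,N'}, β_{N,N'})` with their squares / isometry / degree / base-Frobenius clauses;
  `atLevel_ofConnectedTemperoidFamily_eq` (levels = `ofConnectedTemperoidData`, definitionally, `M ∈ E`);
  `strvSection_atLevel_…`, `facts_atLevel_…` (from `hH` + `ConstantsActByCyclotome` at the level);
* `hinvc_family_ofConnectedTemperoid` / `hinvp_family_ofConnectedTemperoid` — the divisor inputs at every level from the
  `Π^tp_X`-stability `hθ`/`hθ'` of `Div(s')`/`Div(s'')` (Prop. 4.3 (i) proof p.317; §5 p.330);
* `BiKummerSetting.mkOfConnectedTemperoidYddTower 𝒯 ιX` — the §5 choice `A_⊙^bs := Ÿ` for a §2 tower (`Π^tp_Ÿ = 𝒯.PiYdd`), with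
  `hH_mkOfConnectedTemperoidYddTower` (the binder `hH` a THEOREM) and `mkOfConnectedTemperoidYddTower_eq_level` (rfl).
HONEST FRAMING: constructions / kernel-checked implications over abc-iut-L2-t3's / abc-iut-L3's data structures; no side taken downstream.
-/

noncomputable section

namespace Literature.AnabelianGeometry.EtaleTheta

open CategoryTheory Opposite Literature.AlgebraicGeometry.Frobenioids Literature.AnabelianGeometry.SemiGraphs
  Literature.AnabelianGeometry.SemiGraphs.GaloisObjects

universe u₀ v₀ w

namespace BiKummerSetting

variable {K : Type u₀} [Field K] (X : SemiGraphs.TemperedArithmeticGroup.{u₀} K) {D₀ : Type u₀} [Category.{v₀} D₀]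
  {V : FrdIMonoidStub.{w}} {T₀ : RealifiedDivisorMonoids (D₀ := D₀) V}
  {VD : FrdICatStub.{u₀ + 1, u₀, w} (ConnectedPart (BTemp X.Pi))}
  (tf : TemperedFrobenioid T₀ (ConnectedPart (BTemp X.Pi)) VD) (hZ : tf.monoidType = MonoidType.Z)
  (hP : ∀ A : (ConnectedPart (BTemp X.Pi))ᵒᵖ, IsPerfect (tf.Φ.carrier A))
  (NH : Subgroup (Field.absoluteGaloisGroup K) → tf.category → ℕ+ → Prop)
  {E : Set ℕ+} (𝒯 : ThetaEnvTower.{max u₀ w} E) (ιX : 𝒯.PiX ≃ₜ* X.Pi)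

/-- **The §5 setting over `B^temp(Π^tp_X)⁰` with `A_⊙^bs := Ÿ`, tower form** (`Π^tp_Ÿ = 𝒯.PiYdd`, the same at every level).
[cite: MochizukiEtTh2009, §5 p.330 (PDF p.104); Def 4.1 p.312 (PDF p.86)] -/
def mkOfConnectedTemperoidYddTower : BiKummerSetting X T₀ (ConnectedPart (BTemp X.Pi)) VD :=
  mkOfConnectedTemperoidYdd X tf hZ hP NH (𝒯.level ⟨1, 𝒯.one_mem⟩) ιX

/-- The tower form IS the one-level form at every level `M ∈ E` (definitionally). [cite: MochizukiEtTh2009, §5 p.330 (PDF p.104)] -/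
theorem mkOfConnectedTemperoidYddTower_eq_level (M : E) :
    mkOfConnectedTemperoidYddTower X tf hZ hP NH 𝒯 ιX = mkOfConnectedTemperoidYdd X tf hZ hP NH (𝒯.level M) ιX := rfl

/-- **`hH` is a THEOREM for the tower form.** [cite: MochizukiEtTh2009, §5 p.330 (PDF p.104)] -/
theorem hH_mkOfConnectedTemperoidYddTower :
    ∀ y : 𝒯.PiX, y ∈ 𝒯.PiYdd → ιX y ∈ (mkOfConnectedTemperoidYddTower X tf hZ hP NH 𝒯 ιX).Hodot :=
  hH_mkOfConnectedTemperoidYdd X tf hZ hP NH (𝒯.level ⟨1, 𝒯.one_mem⟩) ιX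

end BiKummerSetting

namespace ThetaFrobenioidTower

variable {K : Type u₀} [Field K] {X : SemiGraphs.TemperedArithmeticGroup.{u₀} K} {D₀ : Type u₀} [Category.{v₀} D₀]
  {V : FrdIMonoidStub.{w}} {T₀ : RealifiedDivisorMonoids (D₀ := D₀) V}
  {VD : FrdICatStub.{u₀ + 1, u₀, w} (ConnectedPart (BTemp X.Pi))}
  {tf : TemperedFrobenioid T₀ (ConnectedPart (BTemp X.Pi)) VD} {hZ : tf.monoidType = MonoidType.Z}
  {hP : ∀ A : (ConnectedPart (BTemp X.Pi))ᵒᵖ, IsPerfect (tf.Φ.carrier A)}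
  {NH : Subgroup (Field.absoluteGaloisGroup K) → tf.category → ℕ+ → Prop} {A₀ : tf.category}
  {hA₀ : PreFrobenioid.IsFrobeniusTrivial tf.toElem A₀} {hA₀' : SemiGraphs.IsGaloisObj A₀.base.obj}
  {pullFrac : ∀ {A A' : (BiKummerSetting.mkOfConnectedTemperoid X tf hZ hP NH A₀ hA₀ hA₀').C} (_ : A' ⟶ A),
    (BiKummerSetting.mkOfConnectedTemperoid X tf hZ hP NH A₀ hA₀ hA₀').biratUnits A →
      (BiKummerSetting.mkOfConnectedTemperoid X tf hZ hP NH A₀ hA₀ hA₀').biratUnits A'}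
  {lv : ℕ+} {E : Set ℕ+} {𝒯 : ThetaEnvTower.{max u₀ w} E}
  {θ : (BiKummerSetting.mkOfConnectedTemperoid X tf hZ hP NH A₀ hA₀ hA₀').biratUnits
    (BiKummerSetting.mkOfConnectedTemperoid X tf hZ hP NH A₀ hA₀ hA₀').Aodot}
  {Bl : (BiKummerSetting.mkOfConnectedTemperoid X tf hZ hP NH A₀ hA₀ hA₀').C}
  {Pl : (BiKummerSetting.mkOfConnectedTemperoid X tf hZ hP NH A₀ hA₀ hA₀').FractionPair θ Bl}
  {Rl : (BiKummerSetting.mkOfConnectedTemperoid X tf hZ hP NH A₀ hA₀ hA₀').NthRoot θ Pl lv pullFrac}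
  (h : ModelFrobenioid.Hypotheses tf.divisorMonoid tf.ratFnFunctor)
  (Q : FrobenioidTheta.ThetaSubquotientStub.{w} (ConnectedPart (BTemp X.Pi))) (odd_l : Odd (lv : ℕ))
  (R : ∀ N : ℕ+, (BiKummerSetting.mkOfConnectedTemperoid X tf hZ hP NH A₀ hA₀ hA₀').NthRoot Rl.root Rl.pair N pullFrac)
  (ιX : 𝒯.PiX ≃ₜ* X.Pi) (K' : Type w) [Field K'] (constEmb : ∀ N : ℕ+, K'ˣ →* tf.biratUnitsModel (R N).BN)
  (constEmb_injective : ∀ N : ℕ+, Function.Injective (constEmb N))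
  (hinvc : ∀ (N : ℕ+) (g : Aut (R N).AN.base),
    pull tf.divisorMonoid g.hom (ModelFrobenioid.div (R N).pair.num) = ModelFrobenioid.div (R N).pair.num)
  (hinvp : ∀ (N : ℕ+) (y : 𝒯.PiX), y ∈ 𝒯.PiYdd →
    pull tf.divisorMonoid ((BiKummerSetting.mkOfConnectedTemperoid X tf hZ hP NH A₀ hA₀ hA₀').galoisSurj (R N).AN.base
      (R N).αData.isGalois (ιX y)).hom (ModelFrobenioid.div (R N).pair.den) = ModelFrobenioid.div (R N).pair.den)
  (α : ∀ {N N' : ℕ+}, (N : ℕ) ∣ N' → ((R N').AN ⟶ (R N).AN))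
  (β : ∀ {N N' : ℕ+}, (N : ℕ) ∣ N' → ((R N').BN ⟶ (R N).BN))
  (comm_sCap : ∀ {N N' : ℕ+} (hd : (N : ℕ) ∣ N'), (R N').pair.num ≫ β hd = α hd ≫ (R N).pair.num)
  (comm_sCup : ∀ {N N' : ℕ+} (hd : (N : ℕ) ∣ N'), (R N').pair.den ≫ β hd = α hd ≫ (R N).pair.den)
  (isIsometry_α : ∀ {N N' : ℕ+} (hd : (N : ℕ) ∣ N'),
    ((BiKummerSetting.mkOfConnectedTemperoid X tf hZ hP NH A₀ hA₀ hA₀').sec5Stub h).pre.IsIsometry (α hd))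
  (degFr_α : ∀ {N N' : ℕ+} (hd : (N : ℕ) ∣ N'),
    (((BiKummerSetting.mkOfConnectedTemperoid X tf hZ hP NH A₀ hA₀ hA₀').sec5Stub h).pre.degFr (α hd) : ℕ) * N = N')
  (isIsometry_β : ∀ {N N' : ℕ+} (hd : (N : ℕ) ∣ N'),
    ((BiKummerSetting.mkOfConnectedTemperoid X tf hZ hP NH A₀ hA₀ hA₀').sec5Stub h).pre.IsIsometry (β hd))
  (degFr_β : ∀ {N N' : ℕ+} (hd : (N : ℕ) ∣ N'),
    (((BiKummerSetting.mkOfConnectedTemperoid X tf hZ hP NH A₀ hA₀ hA₀').sec5Stub h).pre.degFr (β hd) : ℕ) * N = N')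
  (baseFrob_α : ∀ {N N' : ℕ+} (hd : (N : ℕ) ∣ N'),
    (BiKummerSetting.mkOfConnectedTemperoid X tf hZ hP NH A₀ hA₀ hA₀').IsOfBaseFrobeniusType (α hd))

include hinvp in
/-- Tower form of `hdivp` for the constructed sections (Prop. 4.3 (i) proof, p.317 (PDF p.91)). [cite: MochizukiEtTh2009, Prop 4.3 (i) p.317 (PDF p.91)] -/
theorem div_strv_comp_den_connFamily (N : ℕ+) (y : 𝒯.PiYdd) :
    ModelFrobenioid.div ((ThetaFrobenioid.strvOfBiKummerData h (R N)
        ((BiKummerSetting.mkOfConnectedTemperoid X tf hZ hP NH A₀ hA₀ hA₀').galoisSurj (R N).AN.base (R N).αData.isGalois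
          (ιX y.1))).hom ≫ (R N).pair.den) = ModelFrobenioid.div (R N).pair.den := by
  have hc := ModelFrobenioid.div_comp_of_isIso' h.isDivisorial
    (ThetaFrobenioid.strvOfBiKummerData h (R N)
      ((BiKummerSetting.mkOfConnectedTemperoid X tf hZ hP NH A₀ hA₀ hA₀').galoisSurj (R N).AN.base (R N).αData.isGalois
        (ιX y.1))).hom (R N).pair.den
  rw [ThetaFrobenioid.baseMap_strvOfBiKummerData] at hc
  exact hc.trans (hinvp N y.1 y.2)

/-- **The [EtTh] §5 tower over the GENUINE connected base `B^temp(Π^tp_X)⁰`**: `ofBiKummerFamily` over `mkOfConnectedTemperoid`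
with `hopen` DISCHARGED at every level, `s^trv_N := strvOfBiKummerData` CONSTRUCTED, `hdivc`/`hdivp` from `hinvc`/`hinvp`, and
`ρ_comm_β` DISCHARGED (`rho_comm_β_of_natural` + `mkOfConnectedTemperoid_galoisSurj_natural`); inputs left: the Rmk. 4.3.2 transitions and their clauses.
[cite: MochizukiEtTh2009, Rmk 4.3.2 p.318–319 (PDF pp.92–93); §5 p.330–331 (PDF pp.104–105)] -/
def ofConnectedTemperoidFamily :
    ThetaFrobenioidTower.{w} (BiKummerSetting.mkOfConnectedTemperoid X tf hZ hP NH A₀ hA₀ hA₀').C (ConnectedPart (BTemp X.Pi)) :=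
  ofBiKummerFamily h (fun _ => MonoidHom.id _) Q odd_l R ιX
    (fun N => BiKummerSetting.mkOfConnectedTemperoid_isOpen_ker_galoisSurj X tf hZ hP NH A₀ hA₀ hA₀' (R N).AN.base
      (R N).αData.isGalois)
    (fun N => ThetaFrobenioid.strvOfBiKummerData h (R N)) K' constEmb constEmb_injective
    (fun N => ThetaFrobenioid.hdivc_of_pull_invariant h.isDivisorial (R N) (ThetaFrobenioid.strvOfBiKummerData h (R N))
      (ThetaFrobenioid.baseMap_strvOfBiKummerData h (R N)) (hinvc N))
    (div_strv_comp_den_connFamily h R ιX hinvp)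
    α β comm_sCap comm_sCup isIsometry_α degFr_α isIsometry_β degFr_β baseFrob_α
    (fun hd => rho_comm_β_of_natural R ιX
      (BiKummerSetting.mkOfConnectedTemperoid_galoisSurj_natural X tf hZ hP NH A₀ hA₀ hA₀') α β comm_sCap hd)

/-- **The levels of the tower ARE the §5 data `ofConnectedTemperoidData`** over `𝒯.level M` (definitionally, `M ∈ E`).
[cite: MochizukiEtTh2009, §5 p.330–331 (PDF pp.104–105)] -/
theorem atLevel_ofConnectedTemperoidFamily_eq (M : E) :
    (ofConnectedTemperoidFamily h Q odd_l R ιX K' constEmb constEmb_injective hinvc hinvp α β comm_sCap comm_sCup isIsometry_α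
        degFr_α isIsometry_β degFr_β baseFrob_α).atLevel M =
      ThetaFrobenioid.ofConnectedTemperoidData (T := 𝒯.level M) h Q odd_l (R M) ιX K' (constEmb M) (constEmb_injective M)
        (hinvc M) (hinvp M) := rfl

/-- `StrvSection` at every level (unconditional). [cite: MochizukiEtTh2009, §5 p.331 (PDF p.105)] -/
theorem strvSection_atLevel_ofConnectedTemperoidFamily (N : ℕ+) :
    ((ofConnectedTemperoidFamily h Q odd_l R ιX K' constEmb constEmb_injective hinvc hinvp α β comm_sCap comm_sCup isIsometry_α
        degFr_α isIsometry_β degFr_β baseFrob_α).atLevel N).StrvSection := by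
  delta ofConnectedTemperoidFamily
  rw [atLevel_ofBiKummerFamily (K' := K') (ρ_comm_β := fun hd => rho_comm_β_of_natural R ιX
      (BiKummerSetting.mkOfConnectedTemperoid_galoisSurj_natural X tf hZ hP NH A₀ hA₀ hA₀') α β comm_sCap hd)]
  exact strvSection_levelData _ _ _ _ _ _ _ _ _ _ _ _ _ (fun N g => ThetaFrobenioid.baseMap_strvOfBiKummerData h (R N) g) N

/-- **`Facts` at every level** from `hH` (`Π^tp_Ÿ ⊆ H_⊙`) and `ConstantsActByCyclotome` at that level.
[cite: MochizukiEtTh2009, §5 p.330–331 (PDF pp.104–105)] -/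
theorem facts_atLevel_ofConnectedTemperoidFamily
    (hH : ∀ y : 𝒯.PiX, y ∈ 𝒯.PiYdd → ιX y ∈ (BiKummerSetting.mkOfConnectedTemperoid X tf hZ hP NH A₀ hA₀ hA₀').Hodot) (N : ℕ+)
    (hK : ((ofConnectedTemperoidFamily h Q odd_l R ιX K' constEmb constEmb_injective hinvc hinvp α β comm_sCap comm_sCup
      isIsometry_α degFr_α isIsometry_β degFr_β baseFrob_α).atLevel N).ConstantsActByCyclotome) :
    ((ofConnectedTemperoidFamily h Q odd_l R ιX K' constEmb constEmb_injective hinvc hinvp α β comm_sCap comm_sCup isIsometry_α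
        degFr_α isIsometry_β degFr_β baseFrob_α).atLevel N).Facts := by
  revert hK
  delta ofConnectedTemperoidFamily
  rw [atLevel_ofBiKummerFamily (K' := K') (ρ_comm_β := fun hd => rho_comm_β_of_natural R ιX
      (BiKummerSetting.mkOfConnectedTemperoid_galoisSurj_natural X tf hZ hP NH A₀ hA₀ hA₀') α β comm_sCap hd)]
  intro hK
  exact facts_levelData _ _ _ _ _ _ _ _ _ _ _ _ _
    (fun N g => ThetaFrobenioid.baseMap_strvOfBiKummerData h (R N) g) hH
    (fun s' s'' _ _ _ => BiKummerSetting.coe_fracOfModel_mul_unit tf T₀.isUnit_BΛ s' s'')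
    (fun e x => BiKummerSetting.coe_biratAutModel_eq_pull tf e x) N hK

include h in
/-- **`hinvc` at every level from the `Π^tp_X`-stability `hθ` of `Div(s')`.** [cite: MochizukiEtTh2009, §5 p.330 (PDF p.104)] -/
theorem hinvc_family_ofConnectedTemperoid
    (hθ : ∀ x : X.Pi, pull tf.divisorMonoid ((BiKummerSetting.mkOfConnectedTemperoid X tf hZ hP NH A₀ hA₀ hA₀').galoisSurj
      A₀.base hA₀' x).hom (ModelFrobenioid.div Pl.num) = ModelFrobenioid.div Pl.num) (N : ℕ+) (g : Aut (R N).AN.base) :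
    pull tf.divisorMonoid g.hom (ModelFrobenioid.div (R N).pair.num) = ModelFrobenioid.div (R N).pair.num :=
  ThetaFrobenioid.hinvc_of_thetaDivisor (R N) h.isDivisorial
    (BiKummerSetting.mkOfConnectedTemperoid_galoisSurj_natural X tf hZ hP NH A₀ hA₀ hA₀') hθ g

include h in
/-- **`hinvp` at every level from the `Π^tp_X`-stability `hθ'` of `Div(s'')`** (for all `y`, in particular on `Π^tp_Ÿ`).
[cite: MochizukiEtTh2009, Prop 4.3 (i) p.317 (PDF p.91)] -/
theorem hinvp_family_ofConnectedTemperoid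
    (hθ' : ∀ x : X.Pi, pull tf.divisorMonoid ((BiKummerSetting.mkOfConnectedTemperoid X tf hZ hP NH A₀ hA₀ hA₀').galoisSurj
      A₀.base hA₀' x).hom (ModelFrobenioid.div Pl.den) = ModelFrobenioid.div Pl.den) (N : ℕ+) (y : 𝒯.PiX) (_hy : y ∈ 𝒯.PiYdd) :
    pull tf.divisorMonoid ((BiKummerSetting.mkOfConnectedTemperoid X tf hZ hP NH A₀ hA₀ hA₀').galoisSurj (R N).AN.base
      (R N).αData.isGalois (ιX y)).hom (ModelFrobenioid.div (R N).pair.den) = ModelFrobenioid.div (R N).pair.den :=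
  BiKummerSetting.NthRoot.pull_galoisSurj_div_den (R N) Rl.αData.isGalois h.isDivisorial
    (BiKummerSetting.mkOfConnectedTemperoid_galoisSurj_natural X tf hZ hP NH A₀ hA₀ hA₀')
    (BiKummerSetting.NthRoot.pull_galoisSurj_div_den Rl hA₀' h.isDivisorial
      (BiKummerSetting.mkOfConnectedTemperoid_galoisSurj_natural X tf hZ hP NH A₀ hA₀ hA₀') hθ') (ιX y)

end ThetaFrobenioidTower

end Literature.AnabelianGeometry.EtaleTheta

end
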